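import Mathlib
import Summits.MatrixMultiplication.MatrixMultiplication.Theorems.SnSubsetDichotomyPolynomialSlackLevelOnePinning
import Summits.MatrixMultiplication.MatrixMultiplication.Theorems.SnSubsetDichotomyPolynomialSlackMarginals
import Summits.MatrixMultiplication.MatrixMultiplication.Theorems.SnSubsetDichotomyPolynomialSlackPositivity

/-!
# The level-one pinning in normalised (profile) form

Crux `Summit.MatrixMultiplication.MatrixMultiplication.Theses.SnSubsetDichotomy.PolynomialSlack`
(item `stmt-MatrixMultiplication-8306`), level-one programme, line transport-split-hull. For a
parity-pure TPP triple `S, T, U ⊆ S_n` (`n ≥ 40`) with `N = |S||T||U|`, quotient sizes `α = |S||T|`,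
`β = |T||U|`, `γ = |U||S|` (`αβγ = N²`) and the pair marginals
`m_{XY}(i,j) = #{(x,y) ∈ X × Y : y j = x i}`, the pinning `levelOnePinning`
(`2N² - n!·N - N·n!√(n!)/√(n(n-1)/6) ≤ 2(n-1)(N² - T₃)`), the counting identity
`sixFoldFix_eq_tripleSum` (`T₃ = Σ m_{ST} m_{TU} m_{US}`) and the centring identity
`centered_tripleSum_eq` (`Σ (a-1/n)(b-1/n)(c-1/n) = Σ abc - 1` for arrays with unit row and column
sums, here `a = m_{ST}/α`, `b = m_{TU}/β`, `c = m_{US}/γ`, so that `Σ abc = T₃/N²`) give, after division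
by `2N² > 0`,

* `pinning_normalized` —
  `1 - n!/(2N) - n!√(n!)/(2N√(n(n-1)/6)) ≤ -(n-1)·Σ_{ijk} (a_{ij}-1/n)(b_{jk}-1/n)(c_{ki}-1/n)`.
-/

namespace Summit.MatrixMultiplication.MatrixMultiplication.Theorems.PolynomialSlack

open scoped BigOperators
open Literature.Combinatorics.Additive (TripleProductProperty)

-- `Summit.<Summit>.<Problem>` is the tree's mandated summit-side namespace (CONVENTIONS §2); for
-- this single-conjunct summit the two coincide, so each declaration silences `dupNamespace`.
set_option linter.dupNamespace false

/-- **Level-one pinning, normalised form.** For `n ≥ 40` and a parity-pure TPP triple `S, T, U ⊆ S_n` of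
nonempty sets with `N = |S||T||U|`, the centred normalised pair marginals
`a_{ij} - 1/n = m_{ST}(i,j)/(|S||T|) - 1/n`, `b_{jk} - 1/n = m_{TU}(j,k)/(|T||U|) - 1/n`,
`c_{ki} - 1/n = m_{US}(k,i)/(|U||S|) - 1/n` satisfy
`1 - n!/(2N) - n!√(n!)/(2N·√(n(n-1)/6)) ≤ -(n-1)·Σ_{i,j,k} (a_{ij}-1/n)(b_{jk}-1/n)(c_{ki}-1/n)`:
the pinning `levelOnePinning` divided by `2N²`, with `T₃/N² - 1 = Σ (a-1/n)(b-1/n)(c-1/n)`. [folklore] -/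
theorem pinning_normalized (n : ℕ) (hn : 40 ≤ n) (S T U : Finset (Equiv.Perm (Fin n)))
    (hTPP : TripleProductProperty S T U) (hS0 : S.Nonempty) (hT0 : T.Nonempty) (hU0 : U.Nonempty)
    (hS : ∀ s ∈ S, ∀ s' ∈ S, Equiv.Perm.sign s = Equiv.Perm.sign s')
    (hT : ∀ t ∈ T, ∀ t' ∈ T, Equiv.Perm.sign t = Equiv.Perm.sign t')
    (hU : ∀ u ∈ U, ∀ u' ∈ U, Equiv.Perm.sign u = Equiv.Perm.sign u') :
    1 - (n.factorial : ℝ) / (2 * (S.card * T.card * U.card : ℕ)) -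
        (n.factorial : ℝ) * Real.sqrt (n.factorial : ℝ) /
          (2 * (S.card * T.card * U.card : ℕ) * Real.sqrt (((n * (n - 1) : ℕ) : ℝ) / 6)) ≤
      -((n : ℝ) - 1) * ∑ i : Fin n, ∑ j : Fin n, ∑ k : Fin n,
        ((((S ×ˢ T).filter fun st => st.2 j = st.1 i).card : ℝ) / (S.card * T.card : ℕ) - 1 / n) *
          ((((T ×ˢ U).filter fun tu => tu.2 k = tu.1 j).card : ℝ) / (T.card * U.card : ℕ) - 1 / n) *
          ((((U ×ˢ S).filter fun us => us.2 i = us.1 k).card : ℝ) / (U.card * S.card : ℕ) - 1 / n) := by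
  classical
  set P : ℝ := ((S.card * T.card * U.card : ℕ) : ℝ) with hP
  have hn0 : n ≠ 0 := by omega
  have hD0 : 0 < Real.sqrt (((n * (n - 1) : ℕ) : ℝ) / 6) := by
    apply Real.sqrt_pos.2; apply div_pos _ (by norm_num)
    have : 0 < n * (n - 1) := Nat.mul_pos (by omega) (by omega)
    exact_mod_cast this
  have hNpos : (0 : ℝ) < P := by
    rw [hP]; exact_mod_cast Nat.mul_pos (Nat.mul_pos hS0.card_pos hT0.card_pos) hU0.card_pos
  -- quotient sizes
  set α : ℝ := ((S.card * T.card : ℕ) : ℝ) with hα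
  set β : ℝ := ((T.card * U.card : ℕ) : ℝ) with hβ
  set γ : ℝ := ((U.card * S.card : ℕ) : ℝ) with hγ
  have hα0 : 0 < α := by rw [hα]; exact_mod_cast Nat.mul_pos hS0.card_pos hT0.card_pos
  have hβ0 : 0 < β := by rw [hβ]; exact_mod_cast Nat.mul_pos hT0.card_pos hU0.card_pos
  have hγ0 : 0 < γ := by rw [hγ]; exact_mod_cast Nat.mul_pos hU0.card_pos hS0.card_pos
  have hNsq : α * β * γ = P ^ 2 := by rw [hα, hβ, hγ, hP]; push_cast; ring
  -- (1) the pinning and the six-fold count as a triple sum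
  have hpin := levelOnePinning n hn S T U hTPP hS hT hU
  set mA : Fin n → Fin n → ℝ := fun i j => (((S ×ˢ T).filter fun st => st.2 j = st.1 i).card : ℝ) with hmA
  set mB : Fin n → Fin n → ℝ := fun i j => (((T ×ˢ U).filter fun tu => tu.2 j = tu.1 i).card : ℝ) with hmB
  set mC : Fin n → Fin n → ℝ := fun i j => (((U ×ˢ S).filter fun us => us.2 j = us.1 i).card : ℝ) with hmC
  have hT3 : ((∑ y ∈ ((S ×ˢ T) ×ˢ (T ×ˢ U)) ×ˢ (U ×ˢ S),
      (Finset.univ.filter fun p : Fin n =>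
        (y.1.1.1⁻¹ * y.1.1.2 * (y.1.2.1⁻¹ * y.1.2.2) * (y.2.1⁻¹ * y.2.2)) p = p).card : ℕ) : ℝ) =
      ∑ i : Fin n, ∑ j : Fin n, ∑ k : Fin n, mA i j * mB j k * mC k i := by
    rw [sixFoldFix_eq_tripleSum S T U]
    push_cast
    refine Finset.sum_congr rfl fun i _ => ?_
    rw [Finset.sum_comm]
    refine Finset.sum_congr rfl fun j _ => Finset.sum_congr rfl fun k _ => ?_
    simp only [hmA, hmB, hmC]; ring
  -- (2) normalised arrays and the centring identity
  set a : Fin n → Fin n → ℝ := fun i j => mA i j / α with ha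
  set b : Fin n → Fin n → ℝ := fun i j => mB i j / β with hb
  set c : Fin n → Fin n → ℝ := fun i j => mC i j / γ with hc
  have hsndA : ∀ i, ∑ j : Fin n, mA i j = α := fun i => by
    have h : ∑ j : Fin n, ((((S ×ˢ T).filter fun st => st.2 j = st.1 i).card : ℕ) : ℝ) =
        ((S.card * T.card : ℕ) : ℝ) := by exact_mod_cast sum_pairMarginal_snd S T i
    exact h
  have hsndB : ∀ i, ∑ j : Fin n, mB i j = β := fun i => by
    have h : ∑ j : Fin n, ((((T ×ˢ U).filter fun tu => tu.2 j = tu.1 i).card : ℕ) : ℝ) =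
        ((T.card * U.card : ℕ) : ℝ) := by exact_mod_cast sum_pairMarginal_snd T U i
    exact h
  have hfstB : ∀ j, ∑ i : Fin n, mB i j = β := fun j => by
    have h : ∑ i : Fin n, ((((T ×ˢ U).filter fun tu => tu.2 j = tu.1 i).card : ℕ) : ℝ) =
        ((T.card * U.card : ℕ) : ℝ) := by exact_mod_cast sum_pairMarginal_fst T U j
    exact h
  have hsndC : ∀ i, ∑ j : Fin n, mC i j = γ := fun i => by
    have h : ∑ j : Fin n, ((((U ×ˢ S).filter fun us => us.2 j = us.1 i).card : ℕ) : ℝ) =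
        ((U.card * S.card : ℕ) : ℝ) := by exact_mod_cast sum_pairMarginal_snd U S i
    exact h
  have hfstC : ∀ j, ∑ i : Fin n, mC i j = γ := fun j => by
    have h : ∑ i : Fin n, ((((U ×ˢ S).filter fun us => us.2 j = us.1 i).card : ℕ) : ℝ) =
        ((U.card * S.card : ℕ) : ℝ) := by exact_mod_cast sum_pairMarginal_fst U S j
    exact h
  have har : ∀ i, ∑ j : Fin n, a i j = 1 := fun i => by
    simp only [ha]; rw [← Finset.sum_div, div_eq_one_iff_eq hα0.ne', hsndA]
  have hbr : ∀ j, ∑ k : Fin n, b j k = 1 := fun j => by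
    simp only [hb]; rw [← Finset.sum_div, div_eq_one_iff_eq hβ0.ne', hsndB]
  have hbc : ∀ k, ∑ j : Fin n, b j k = 1 := fun k => by
    simp only [hb]; rw [← Finset.sum_div, div_eq_one_iff_eq hβ0.ne', hfstB]
  have hcr : ∀ k, ∑ i : Fin n, c k i = 1 := fun k => by
    simp only [hc]; rw [← Finset.sum_div, div_eq_one_iff_eq hγ0.ne', hsndC]
  have hcc : ∀ i, ∑ k : Fin n, c k i = 1 := fun i => by
    simp only [hc]; rw [← Finset.sum_div, div_eq_one_iff_eq hγ0.ne', hfstC]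
  have hcen := centered_tripleSum_eq hn0 a b c har hbr hbc hcr hcc
  have habc : ∑ i : Fin n, ∑ j : Fin n, ∑ k : Fin n, a i j * b j k * c k i =
      (∑ i : Fin n, ∑ j : Fin n, ∑ k : Fin n, mA i j * mB j k * mC k i) / (α * β * γ) := by
    rw [Finset.sum_div]
    refine Finset.sum_congr rfl fun i _ => ?_
    rw [Finset.sum_div]
    refine Finset.sum_congr rfl fun j _ => ?_
    rw [Finset.sum_div]
    refine Finset.sum_congr rfl fun k _ => ?_
    simp only [ha, hb, hc]
    field_simp
  -- (3) assemble: `2N² - n!N - N n!√(n!)/√D ≤ 2(n-1)(N² - T₃) = 2(n-1)N²·(-Σ PQR)`, divide by `2N²`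
  have hmain : 2 * ((n : ℝ) - 1) * (P ^ 2 -
      ∑ i : Fin n, ∑ j : Fin n, ∑ k : Fin n, mA i j * mB j k * mC k i) =
      2 * P ^ 2 * (-((n : ℝ) - 1) *
        ∑ i : Fin n, ∑ j : Fin n, ∑ k : Fin n, (a i j - 1 / n) * (b j k - 1 / n) * (c k i - 1 / n)) := by
    have hP2 : P ^ 2 ≠ 0 := pow_ne_zero 2 hNpos.ne'
    rw [hcen, habc, hNsq]
    field_simp
    ring
  rw [hT3, Nat.cast_pow, ← hP] at hpin
  have hfin := hpin.trans (le_of_eq hmain)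
  have h2P : (0 : ℝ) < 2 * P ^ 2 := by positivity
  show 1 - (n.factorial : ℝ) / (2 * P) -
        (n.factorial : ℝ) * Real.sqrt (n.factorial : ℝ) /
          (2 * P * Real.sqrt (((n * (n - 1) : ℕ) : ℝ) / 6)) ≤
      -((n : ℝ) - 1) * ∑ i : Fin n, ∑ j : Fin n, ∑ k : Fin n,
        (a i j - 1 / n) * (b j k - 1 / n) * (c k i - 1 / n)
  refine le_of_mul_le_mul_left ?_ h2P
  have e1 : 2 * P ^ 2 * (1 - (n.factorial : ℝ) / (2 * P) -
        (n.factorial : ℝ) * Real.sqrt (n.factorial : ℝ) /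
          (2 * P * Real.sqrt (((n * (n - 1) : ℕ) : ℝ) / 6))) =
      2 * P ^ 2 - (n.factorial : ℝ) * P -
        P * ((n.factorial : ℝ) * Real.sqrt (n.factorial : ℝ)) / Real.sqrt (((n * (n - 1) : ℕ) : ℝ) / 6) := by
    field_simp
  rw [e1]
  exact hfin

end Summit.MatrixMultiplication.MatrixMultiplication.Theorems.PolynomialSlack
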